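import Mathlib
import HarnessLib
import Summits.ValiantsHypothesis.ValiantsHypothesis.Theorems.LacunarySymmetroidMatrixDescartesOsculationLawPeelComponent
import Summits.ValiantsHypothesis.ValiantsHypothesis.Theorems.LacunarySymmetroidMatrixDescartesOsculationLawPeelComponentUnique
import Summits.ValiantsHypothesis.ValiantsHypothesis.Theorems.LacunarySymmetroidMatrixDescartesOsculationLawPeelComponentCount
import Summits.ValiantsHypothesis.ValiantsHypothesis.Theorems.LacunarySymmetroidMatrixDescartesOsculationLawPeelEndCharges
import Summits.ValiantsHypothesis.ValiantsHypothesis.Theorems.LacunarySymmetroidMatrixDescartesOsculationLawPeelMultiplicityAccounting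

/-!
# ValiantsHypothesis / LacunarySymmetroid — crux `MatrixDescartes` (stmt-ValiantsHypothesis-18050, V1),
# line `Cruxes/MatrixDescartes/Lines/osculation_law.lean` («osculation-law»), stub `stub_peel` (ALL ranks):
# THE COMPONENT COUNT — `Z₊mult(g) ≤ 2·#osc + 2r + 2·Z₊mult(a₀) + 2·Z₊mult(a_r)` MODULO THE END COST
# (pieces (γ3)+(γ4) of NOTE-p7g12-peel-general-r-sizing.md §6)

COEFFICIENT FORM `Φ = Σ_{k≤r} X₁^k·ι(a_k)` (the rank-`r` letter by `OsculationLetter.insertionPoly_rank_card`), vertical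
family `P t = Σ_k X^k C(a_k(t))`, hyperbolic for `t > 0`, finite osculation set in general position, arc `b = c·tᴺ`
(`c > 0`) avoiding it, `a₀, a_r ≢ 0`.  THE COUNT: every positive root of `g(t) = Φ(t, c tᴺ)` lies on the COMPONENT
(`exists_component`, horizon `B` beyond all roots) of a unique FIRST root (`component_eq`: components of distinct first
roots are disjoint); on one component the roots number `≤ 2·(#own osculation points + 1)` (p7's
`card_roots_on_branch_le`); the own osculation sets are disjoint, and the components are charged to their RIGHT ENDS:
ALIVE at `B` — at most `natDegree (P B) ≤ r` of them (`card_le_natDegree_of_alive`); ZERO at `ω` — at most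
`rootMultiplicity 0 (P ω)` of them per `ω` (`card_le_rootMultiplicity_of_tendsto_zero`); ESCAPE at `ω` — at most
`rootMultiplicity 0` of the reflected fibre (`card_le_rootMultiplicity_reflect_of_tendsto_atTop`).  The conversion of
these multiplicities into ORDERS OF VANISHING of `a₀`, `a_r` — the END COST «`mult₀(P ω) ≤ ord_ω a₀`», true for
hyperbolic families (Alekseevsky–Kriegl–Losik–Michor 1998, Lemma 3.7, with analytic coefficients) — is taken as the two
HYPOTHESES `hcost0`, `hcostr`; they are discharged at `r = 3` in `…PeelRankThree` from the tree's `no_fold_hyperbolic`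
and `three_le_rootMultiplicity_of_triple_root/_escape`, and are the ONE remaining input for general `r`.
Honest framing: a CONDITIONAL rank-free count toward the OPEN stub `stub_peel` (all `r`); nothing of the summit is
proved; `MatrixDescartes`, the LAW and `VP ≠ VNP` are NOT proved.  No definitions, no named facts.  (val-lit-p4 g13,
helper `--supports stmt-ValiantsHypothesis-18050`; desk RULING #279 (a).)
-/

-- `Summit.ValiantsHypothesis.ValiantsHypothesis.…` is the tree's mandated single-conjunct layout (Sub = Summit).
set_option linter.dupNamespace false

noncomputable section

namespace Summit.ValiantsHypothesis.ValiantsHypothesis.Theorems.LacunarySymmetroidMatrixDescartes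

open Polynomial Set Filter
open MvPolynomial (pderiv)
open scoped BigOperators Topology

namespace OsculationPeel

/-- **Multiset bookkeeping**: if every element of `M` is counted, with at least its multiplicity, by some `T i`,
`i ∈ s`, then `card M ≤ Σ_{i ∈ s} card (T i)`. [folklore] -/
theorem card_le_sum_card_of_cover {α ι : Type*} [DecidableEq α] (M : Multiset α) (s : Finset ι)
    (T : ι → Multiset α) (h : ∀ x ∈ M, ∃ i ∈ s, M.count x ≤ (T i).count x) :
    Multiset.card M ≤ ∑ i ∈ s, Multiset.card (T i) := by
  classical
  have h1 : Multiset.card M = ∑ x ∈ M.toFinset, M.count x := (Multiset.toFinset_sum_count_eq M).symm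
  have h2 : ∀ x ∈ M.toFinset, M.count x ≤ ∑ i ∈ s, (T i).count x := by
    intro x hx
    obtain ⟨i, hi, hle⟩ := h x (Multiset.mem_toFinset.1 hx)
    exact hle.trans (Finset.single_le_sum (f := fun i => (T i).count x) (fun _ _ => Nat.zero_le _) hi)
  have h3 : ∀ i ∈ s, ∑ x ∈ M.toFinset, (T i).count x ≤ Multiset.card (T i) := by
    intro i _
    calc ∑ x ∈ M.toFinset, (T i).count x
        = ∑ x ∈ M.toFinset ∩ (T i).toFinset, (T i).count x :=
          (Finset.sum_subset Finset.inter_subset_left fun x hx hx' =>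
            Multiset.count_eq_zero_of_notMem fun hm =>
              hx' (Finset.mem_inter.2 ⟨hx, Multiset.mem_toFinset.2 hm⟩)).symm
      _ ≤ ∑ x ∈ (T i).toFinset, (T i).count x :=
          Finset.sum_le_sum_of_subset_of_nonneg Finset.inter_subset_right (fun _ _ _ => Nat.zero_le _)
      _ = Multiset.card (T i) := Multiset.toFinset_sum_count_eq _
  calc Multiset.card M = ∑ x ∈ M.toFinset, M.count x := h1
    _ ≤ ∑ x ∈ M.toFinset, ∑ i ∈ s, (T i).count x := Finset.sum_le_sum h2
    _ = ∑ i ∈ s, ∑ x ∈ M.toFinset, (T i).count x := Finset.sum_comm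
    _ ≤ ∑ i ∈ s, Multiset.card (T i) := Finset.sum_le_sum h3


/-- **The component count modulo the end cost** (pieces (γ3)+(γ4); COEFFICIENT FORM; all `r`).  See the module
docstring.  Hypotheses: `hΦ`/`hP`/`hPr` name the coefficient form, its vertical family and the reflected family;
`hsplit` hyperbolicity for `t > 0`; `hfin` finite osculation set; `hgp` general position of the line (`∂_bΦ ≠ 0` on the
osculation set, which the arc `b = c·tᴺ` avoids); `ha0`/`har` the end coefficients are not identically zero;
`hcost0`/`hcostr` the END COST (multiplicity of the root `0` of the fibre, resp. of the reflected fibre, at `ω > 0` is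
at most the order of vanishing of `a₀`, resp. `a_r`, at `ω`).  Conclusion: the positive roots of `g(t) = Φ(t, c tᴺ)`,
with multiplicity, number at most `2·#osc + 2r + 2·Z₊mult(a₀) + 2·Z₊mult(a_r)`. [folklore; the line's card, via
components] -/
theorem peel_curve_of_endCost (r : ℕ) (a : ℕ → ℝ[X]) (Φ : MvPolynomial (Fin 2) ℝ)
    (hΦ : Φ = ∑ k ∈ Finset.range (r + 1), (MvPolynomial.X 1 : MvPolynomial (Fin 2) ℝ) ^ k *
      Polynomial.aeval (MvPolynomial.X 0 : MvPolynomial (Fin 2) ℝ) (a k))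
    (P : ℝ → ℝ[X]) (hPdef : ∀ t, P t = ∑ k ∈ Finset.range (r + 1), (X : ℝ[X]) ^ k * Polynomial.C ((a k).eval t))
    (Pr : ℝ → ℝ[X]) (hPr : ∀ t, Pr t = ∑ k ∈ Finset.range (r + 1), (X : ℝ[X]) ^ k * Polynomial.C ((a (r - k)).eval t))
    (hsplit : ∀ t, 0 < t → (P t).Splits)
    (hfin : {p : Fin 2 → ℝ | 0 < p 0 ∧ 0 < p 1 ∧ MvPolynomial.eval p Φ = 0 ∧
      MvPolynomial.eval p
        (MvPolynomial.X 0 * MvPolynomial.pderiv 0 (MvPolynomial.X 0 * MvPolynomial.pderiv 0 Φ)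
            * (MvPolynomial.X 1 * MvPolynomial.pderiv 1 Φ) ^ 2
          - 2 * (MvPolynomial.X 0 * MvPolynomial.pderiv 0 (MvPolynomial.X 1 * MvPolynomial.pderiv 1 Φ))
            * (MvPolynomial.X 0 * MvPolynomial.pderiv 0 Φ) * (MvPolynomial.X 1 * MvPolynomial.pderiv 1 Φ)
          + MvPolynomial.X 1 * MvPolynomial.pderiv 1 (MvPolynomial.X 1 * MvPolynomial.pderiv 1 Φ)
            * (MvPolynomial.X 0 * MvPolynomial.pderiv 0 Φ) ^ 2) = 0}.Finite)
    (c : ℝ) (N : ℕ) (hc : 0 < c) (g : ℝ[X]) (hg : ∀ t, g.eval t = MvPolynomial.eval ![t, c * t ^ N] Φ)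
    (hgp : ∀ p ∈ {p : Fin 2 → ℝ | 0 < p 0 ∧ 0 < p 1 ∧ MvPolynomial.eval p Φ = 0 ∧
      MvPolynomial.eval p
        (MvPolynomial.X 0 * MvPolynomial.pderiv 0 (MvPolynomial.X 0 * MvPolynomial.pderiv 0 Φ)
            * (MvPolynomial.X 1 * MvPolynomial.pderiv 1 Φ) ^ 2
          - 2 * (MvPolynomial.X 0 * MvPolynomial.pderiv 0 (MvPolynomial.X 1 * MvPolynomial.pderiv 1 Φ))
            * (MvPolynomial.X 0 * MvPolynomial.pderiv 0 Φ) * (MvPolynomial.X 1 * MvPolynomial.pderiv 1 Φ)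
          + MvPolynomial.X 1 * MvPolynomial.pderiv 1 (MvPolynomial.X 1 * MvPolynomial.pderiv 1 Φ)
            * (MvPolynomial.X 0 * MvPolynomial.pderiv 0 Φ) ^ 2) = 0},
        MvPolynomial.eval p (MvPolynomial.pderiv 1 Φ) ≠ 0 ∧ p 1 ≠ c * p 0 ^ N)
    (ha0 : a 0 ≠ 0) (har : a r ≠ 0)
    (hcost0 : ∀ t, 0 < t → P t ≠ 0 → (P t).rootMultiplicity 0 ≤ (a 0).rootMultiplicity t)
    (hcostr : ∀ t, 0 < t → P t ≠ 0 → (Pr t).rootMultiplicity 0 ≤ (a r).rootMultiplicity t) :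
    Multiset.card (g.roots.filter (fun t => 0 < t)) ≤
      2 * {p : Fin 2 → ℝ | 0 < p 0 ∧ 0 < p 1 ∧ MvPolynomial.eval p Φ = 0 ∧
      MvPolynomial.eval p
        (MvPolynomial.X 0 * MvPolynomial.pderiv 0 (MvPolynomial.X 0 * MvPolynomial.pderiv 0 Φ)
            * (MvPolynomial.X 1 * MvPolynomial.pderiv 1 Φ) ^ 2
          - 2 * (MvPolynomial.X 0 * MvPolynomial.pderiv 0 (MvPolynomial.X 1 * MvPolynomial.pderiv 1 Φ))
            * (MvPolynomial.X 0 * MvPolynomial.pderiv 0 Φ) * (MvPolynomial.X 1 * MvPolynomial.pderiv 1 Φ)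
          + MvPolynomial.X 1 * MvPolynomial.pderiv 1 (MvPolynomial.X 1 * MvPolynomial.pderiv 1 Φ)
            * (MvPolynomial.X 0 * MvPolynomial.pderiv 0 Φ) ^ 2) = 0}.ncard
      + 2 * r + 2 * Multiset.card ((a 0).roots.filter (fun t => 0 < t))
      + 2 * Multiset.card ((a r).roots.filter (fun t => 0 < t)) := by
  classical
  set osc := {p : Fin 2 → ℝ | 0 < p 0 ∧ 0 < p 1 ∧ MvPolynomial.eval p Φ = 0 ∧
      MvPolynomial.eval p
        (MvPolynomial.X 0 * MvPolynomial.pderiv 0 (MvPolynomial.X 0 * MvPolynomial.pderiv 0 Φ)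
            * (MvPolynomial.X 1 * MvPolynomial.pderiv 1 Φ) ^ 2
          - 2 * (MvPolynomial.X 0 * MvPolynomial.pderiv 0 (MvPolynomial.X 1 * MvPolynomial.pderiv 1 Φ))
            * (MvPolynomial.X 0 * MvPolynomial.pderiv 0 Φ) * (MvPolynomial.X 1 * MvPolynomial.pderiv 1 Φ)
          + MvPolynomial.X 1 * MvPolynomial.pderiv 1 (MvPolynomial.X 1 * MvPolynomial.pderiv 1 Φ)
            * (MvPolynomial.X 0 * MvPolynomial.pderiv 0 Φ) ^ 2) = 0} with hosc
  -- the `hP` currency and basic facts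
  have hP : ∀ t b, (P t).eval b = MvPolynomial.eval ![t, b] Φ := by
    intro t b; rw [hPdef, hΦ]; exact eval_coeffForm r a t b
  have hgp1 : ∀ p ∈ osc, MvPolynomial.eval p (MvPolynomial.pderiv 1 Φ) ≠ 0 := fun p hp => (hgp p hp).1
  have hPne : ∀ t, 0 < t → P t ≠ 0 := fun t ht h0 => not_finite_of_vanishing_fibre Φ P hP ht h0 hfin
  have hdegB : ∀ t, (P t).natDegree ≤ r := fun t => by rw [hPdef]; exact natDegree_coeffForm_le r a t
  -- trivial case `g = 0`
  by_cases hg0 : g = 0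
  · simp [hg0]
  -- the positive roots and the horizon
  set M : Multiset ℝ := g.roots.filter (fun t => 0 < t) with hM
  set Rt : Finset ℝ := M.toFinset with hRt
  have hRt_mem : ∀ t, t ∈ Rt ↔ 0 < t ∧ g.IsRoot t := by
    intro t
    rw [hRt, Multiset.mem_toFinset, hM, Multiset.mem_filter, mem_roots hg0]
    tauto
  set B : ℝ := 1 + ∑ t ∈ Rt, t with hB
  have hRt_ltB : ∀ t ∈ Rt, t < B := by
    intro t ht
    have h1 : t ≤ ∑ u ∈ Rt, u :=
      Finset.single_le_sum (f := fun u => u) (fun u hu => ((hRt_mem u).1 hu).1.le) ht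
    rw [hB]; linarith
  have hB0 : 0 < B := by
    have : 0 ≤ ∑ u ∈ Rt, u := Finset.sum_nonneg fun u hu => ((hRt_mem u).1 hu).1.le
    rw [hB]; linarith
  -- a component through every root
  have hcomp : ∀ t ∈ Rt, ∃ (β : ℝ → ℝ) (α ω : ℝ), 0 ≤ α ∧ α < t ∧ t < ω ∧ ω ≤ B ∧ β t = c * t ^ N ∧
      ContinuousOn β (Ioo α ω) ∧ (∀ u ∈ Ioo α ω, 0 < β u ∧ MvPolynomial.eval ![u, β u] Φ = 0) ∧
      ((ω = B ∧ ContinuousOn β (Ioc α B) ∧ ∀ u ∈ Ioc α B, 0 < β u ∧ MvPolynomial.eval ![u, β u] Φ = 0) ∨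
        Tendsto β (𝓝[<] ω) (𝓝 0) ∨ Tendsto β (𝓝[<] ω) atTop) ∧
      (α = 0 ∨ Tendsto β (𝓝[>] α) (𝓝 0) ∨ Tendsto β (𝓝[>] α) atTop) := by
    intro t ht
    obtain ⟨ht0, hroot⟩ := (hRt_mem t).1 ht
    have hb0 : 0 < c * t ^ N := mul_pos hc (pow_pos ht0 N)
    have hΦ0 : MvPolynomial.eval ![t, c * t ^ N] Φ = 0 := by rw [← hg]; exact hroot
    exact exists_component Φ P hP hsplit hfin hgp1 ht0 hb0 (hRt_ltB t ht) hΦ0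
  choose! β α ω hα0 hαt htω hωB hβt hcont hsol hRk hLk using hcomp
  -- two components sharing a point coincide
  have heq : ∀ ρ ∈ Rt, ∀ ρ' ∈ Rt, ∀ s, s ∈ Ioo (α ρ) (ω ρ) → s ∈ Ioo (α ρ') (ω ρ') → β ρ s = β ρ' s →
      α ρ = α ρ' ∧ ω ρ = ω ρ' ∧ ∀ u ∈ Ioo (α ρ) (ω ρ), β ρ u = β ρ' u := by
    intro ρ hρ ρ' hρ' s hs hs' hββ
    exact component_eq Φ P hP hsplit hfin hgp1 (hα0 ρ hρ) (hα0 ρ' hρ') (hωB ρ hρ) (hωB ρ' hρ')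
      (hcont ρ hρ) (hsol ρ hρ) (hRk ρ hρ) (hLk ρ hρ) (hcont ρ' hρ') (hsol ρ' hρ') (hRk ρ' hρ') (hLk ρ' hρ')
      hs hs' hββ
  -- `t` lies on the component of `ρ`
  have hself : ∀ t ∈ Rt, t ∈ Ioo (α t) (ω t) ∧ β t t = c * t ^ N :=
    fun t ht => ⟨⟨hαt t ht, htω t ht⟩, hβt t ht⟩
  -- the FIRST roots (no smaller root's component passes through them)
  set Rep : Finset ℝ := Rt.filter (fun ρ => ∀ t ∈ Rt, t < ρ → ¬ (ρ ∈ Ioo (α t) (ω t) ∧ β t ρ = c * ρ ^ N))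
    with hRep
  have hRep_sub : Rep ⊆ Rt := Finset.filter_subset _ _
  -- COVER: every root lies on the component of a first root
  have hcover : ∀ t ∈ Rt, ∃ ρ ∈ Rep, t ∈ Ioo (α ρ) (ω ρ) ∧ β ρ t = c * t ^ N := by
    intro t ht
    set S : Finset ℝ := Rt.filter (fun ρ => t ∈ Ioo (α ρ) (ω ρ) ∧ β ρ t = c * t ^ N) with hS
    have hSne : S.Nonempty := ⟨t, by rw [hS, Finset.mem_filter]; exact ⟨ht, hself t ht⟩⟩
    set ρ := S.min' hSne with hρdef
    have hρS : ρ ∈ S := Finset.min'_mem S hSne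
    rw [hS, Finset.mem_filter] at hρS
    obtain ⟨hρRt, hton⟩ := hρS
    refine ⟨ρ, ?_, hton⟩
    rw [hRep, Finset.mem_filter]
    refine ⟨hρRt, fun t' ht' hlt hon => ?_⟩
    -- `t'` and `ρ` share the point `ρ`: same component, so `t` is on the component of `t'` too
    obtain ⟨hαα, hωω, hβββ⟩ := heq t' ht' ρ hρRt ρ hon.1 (hself ρ hρRt).1 (by rw [hon.2, (hself ρ hρRt).2])
    have ht'S : t' ∈ S := by
      rw [hS, Finset.mem_filter]
      refine ⟨ht', ?_, ?_⟩
      · rw [hαα, hωω]; exact hton.1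
      · rw [hβββ t (by rw [hαα, hωω]; exact hton.1)]; exact hton.2
    exact absurd (Finset.min'_le S t' ht'S) (by rw [← hρdef]; exact not_le.2 hlt)
  -- DISJOINT: components of distinct first roots share no point
  have hdisj : ∀ ρ ∈ Rep, ∀ ρ' ∈ Rep, ρ ≠ ρ' → ∀ s, s ∈ Ioo (α ρ) (ω ρ) → s ∈ Ioo (α ρ') (ω ρ') →
      β ρ s ≠ β ρ' s := by
    intro ρ hρ ρ' hρ' hne s hs hs' hββ
    have hρR := hρ; have hρ'R := hρ'
    rw [hRep, Finset.mem_filter] at hρR hρ'R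
    obtain ⟨hαα, hωω, hβββ⟩ := heq ρ hρR.1 ρ' hρ'R.1 s hs hs' hββ
    rcases lt_or_gt_of_ne hne with hlt | hlt
    · -- `ρ < ρ'`: then `ρ'` lies on the component of `ρ`
      refine hρ'R.2 ρ hρR.1 hlt ⟨?_, ?_⟩
      · rw [hαα, hωω]; exact (hself ρ' hρ'R.1).1
      · rw [hβββ ρ' (by rw [hαα, hωω]; exact (hself ρ' hρ'R.1).1)]; exact (hself ρ' hρ'R.1).2
    · refine hρR.2 ρ' hρ'R.1 hlt ⟨?_, ?_⟩
      · rw [← hαα, ← hωω]; exact (hself ρ hρR.1).1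
      · rw [← hβββ ρ (hself ρ hρR.1).1]; exact (hself ρ hρR.1).2
  -- STEP 1: the roots, component by component
  have hstep1 : Multiset.card M ≤
      ∑ ρ ∈ Rep, Multiset.card (g.roots.filter (fun t => α ρ < t ∧ t < ω ρ ∧ β ρ t = c * t ^ N)) := by
    refine card_le_sum_card_of_cover M Rep _ fun x hx => ?_
    have hxRt : x ∈ Rt := by rw [hRt, Multiset.mem_toFinset]; exact hx
    obtain ⟨ρ, hρ, hon⟩ := hcover x hxRt
    refine ⟨ρ, hρ, ?_⟩
    rw [hM, Multiset.count_filter_of_pos ((hRt_mem x).1 hxRt).1,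
      Multiset.count_filter_of_pos (p := fun t => α ρ < t ∧ t < ω ρ ∧ β ρ t = c * t ^ N)
        (show α ρ < x ∧ x < ω ρ ∧ β ρ x = c * x ^ N from ⟨hon.1.1, hon.1.2, hon.2⟩)]
  -- STEP 2: on one component, `≤ 2·(#own osculation points + 1)`
  have hstep2 : ∀ ρ ∈ Rep, Multiset.card (g.roots.filter (fun t => α ρ < t ∧ t < ω ρ ∧ β ρ t = c * t ^ N)) ≤
      2 * ((hfin.toFinset.filter (fun p => α ρ < p 0 ∧ p 0 < ω ρ ∧ p 1 = β ρ (p 0))).card + 1) := by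
    intro ρ hρ
    have hρRt := hRep_sub hρ
    exact card_roots_on_branch_le Φ P hP hsplit hfin c N g hg hgp (hα0 ρ hρRt) (hcont ρ hρRt)
      (fun t ht => (hsol ρ hρRt t ht).1) (fun t ht => (hsol ρ hρRt t ht).2)
  -- STEP 3: the own osculation sets are disjoint
  have hstep3 : ∑ ρ ∈ Rep, (hfin.toFinset.filter (fun p => α ρ < p 0 ∧ p 0 < ω ρ ∧ p 1 = β ρ (p 0))).card ≤
      osc.ncard := by
    rw [Set.ncard_eq_toFinset_card osc hfin, ← Finset.card_biUnion]
    · exact Finset.card_le_card (Finset.biUnion_subset.2 fun ρ _ => Finset.filter_subset _ _)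
    · intro ρ hρ ρ' hρ' hne
      rw [Function.onFun, Finset.disjoint_left]
      intro p hp hp'
      rw [Finset.mem_filter] at hp hp'
      exact hdisj ρ hρ ρ' hρ' hne (p 0) ⟨hp.2.1, hp.2.2.1⟩ ⟨hp'.2.1, hp'.2.2.1⟩ (by rw [← hp.2.2.2, ← hp'.2.2.2])
  -- STEP 4: the first roots are charged to their right ends
  set A : Finset ℝ := Rep.filter (fun ρ => ω ρ = B ∧ ContinuousOn (β ρ) (Ioc (α ρ) B) ∧
      ∀ u ∈ Ioc (α ρ) B, 0 < β ρ u ∧ MvPolynomial.eval ![u, β ρ u] Φ = 0) with hA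
  set Z : Finset ℝ := Rep.filter (fun ρ => Tendsto (β ρ) (𝓝[<] (ω ρ)) (𝓝 0)) with hZ
  set E : Finset ℝ := Rep.filter (fun ρ => Tendsto (β ρ) (𝓝[<] (ω ρ)) atTop) with hE
  have hRep_le : Rep.card ≤ A.card + Z.card + E.card := by
    have hsub : Rep ⊆ A ∪ Z ∪ E := by
      intro ρ hρ
      rcases hRk ρ (hRep_sub hρ) with h | h | h
      · exact Finset.mem_union_left _ (Finset.mem_union_left _ (Finset.mem_filter.2 ⟨hρ, h⟩))
      · exact Finset.mem_union_left _ (Finset.mem_union_right _ (Finset.mem_filter.2 ⟨hρ, h⟩))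
      · exact Finset.mem_union_right _ (Finset.mem_filter.2 ⟨hρ, h⟩)
    calc Rep.card ≤ (A ∪ Z ∪ E).card := Finset.card_le_card hsub
      _ ≤ (A ∪ Z).card + E.card := Finset.card_union_le _ _
      _ ≤ A.card + Z.card + E.card := Nat.add_le_add_right (Finset.card_union_le _ _) _
  -- STEP 4a: ALIVE components are at most `r`
  have hA_le : A.card ≤ r := by
    rcases A.eq_empty_or_nonempty with hAe | hAne
    · rw [hAe, Finset.card_empty]; exact Nat.zero_le _
    · set s := A.max' hAne with hsdef
      have hsA : s ∈ A := Finset.max'_mem A hAne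
      have hsRt : s ∈ Rt := hRep_sub (Finset.mem_filter.1 hsA).1
      have hs0 : 0 < s := ((hRt_mem s).1 hsRt).1
      have hsB : s < B := hRt_ltB s hsRt
      have hmemA : ∀ ρ ∈ A, ρ ∈ Rep ∧ ω ρ = B ∧ ContinuousOn (β ρ) (Ioc (α ρ) B) ∧
          ∀ u ∈ Ioc (α ρ) B, 0 < β ρ u ∧ MvPolynomial.eval ![u, β ρ u] Φ = 0 := fun ρ hρ => Finset.mem_filter.1 hρ
      have hαs : ∀ ρ ∈ A, α ρ < s := fun ρ hρ =>
        (hαt ρ (hRep_sub (hmemA ρ hρ).1)).trans_le (Finset.le_max' A ρ hρ)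
      refine (card_le_natDegree_of_alive Φ P hP hsplit hfin hgp1 A β hs0 hsB.le (hPne B hB0) ?_ ?_ ?_ ?_).trans
        (hdegB B)
      · intro ρ hρ
        exact (hmemA ρ hρ).2.2.1.mono fun u hu => ⟨(hαs ρ hρ).trans_le hu.1, hu.2⟩
      · intro ρ hρ u hu; exact ((hmemA ρ hρ).2.2.2 u ⟨(hαs ρ hρ).trans_le hu.1, hu.2⟩).1
      · intro ρ hρ u hu; exact ((hmemA ρ hρ).2.2.2 u ⟨(hαs ρ hρ).trans_le hu.1, hu.2⟩).2
      · intro ρ hρ ρ' hρ' hne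
        have h1 := hmemA ρ hρ; have h2 := hmemA ρ' hρ'
        exact hdisj ρ h1.1 ρ' h2.1 hne s ⟨hαs ρ hρ, by rw [h1.2.1]; exact hsB⟩ ⟨hαs ρ' hρ', by rw [h2.2.1]; exact hsB⟩
  -- STEP 4b: ZERO ends, charged to `a₀`
  have hZ_le : Z.card ≤ Multiset.card ((a 0).roots.filter (fun t => 0 < t)) := by
    have hmemZ : ∀ ρ ∈ Z, ρ ∈ Rep ∧ Tendsto (β ρ) (𝓝[<] (ω ρ)) (𝓝 0) := fun ρ hρ => Finset.mem_filter.1 hρ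
    -- components with a zero end at `w`
    have hfib : ∀ w : ℝ, (Z.filter (fun ρ => w ∈ ({ω ρ} : Finset ℝ))).card ≤ (a 0).rootMultiplicity w := by
      intro w
      set T : Finset ℝ := Z.filter (fun ρ => w ∈ ({ω ρ} : Finset ℝ)) with hT
      have hmemT : ∀ ρ ∈ T, ρ ∈ Rep ∧ Tendsto (β ρ) (𝓝[<] (ω ρ)) (𝓝 0) ∧ ω ρ = w := by
        intro ρ hρ
        obtain ⟨hρZ, hw⟩ := Finset.mem_filter.1 hρ
        exact ⟨(hmemZ ρ hρZ).1, (hmemZ ρ hρZ).2, (Finset.mem_singleton.1 hw).symm⟩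
      rcases T.eq_empty_or_nonempty with hTe | hTne
      · rw [hTe, Finset.card_empty]; exact Nat.zero_le _
      · set s := T.max' hTne with hsdef
        have hsT : s ∈ T := Finset.max'_mem T hTne
        have hsRt : s ∈ Rt := hRep_sub (hmemT s hsT).1
        have hs0 : 0 < s := ((hRt_mem s).1 hsRt).1
        have hsw : s < w := by rw [← (hmemT s hsT).2.2]; exact htω s hsRt
        have hw0 : 0 < w := hs0.trans hsw
        have hαs : ∀ ρ ∈ T, α ρ < s := fun ρ hρ =>
          (hαt ρ (hRep_sub (hmemT ρ hρ).1)).trans_le (Finset.le_max' T ρ hρ)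
        have hsub : ∀ ρ ∈ T, Ioo s w ⊆ Ioo (α ρ) (ω ρ) := fun ρ hρ u hu =>
          ⟨(hαs ρ hρ).trans hu.1, by rw [(hmemT ρ hρ).2.2]; exact hu.2⟩
        refine (card_le_rootMultiplicity_of_tendsto_zero Φ P hP hsplit hfin hgp1 T β hs0 hsw (hPne w hw0)
          ?_ ?_ ?_ ?_ ?_).trans (hcost0 w hw0 (hPne w hw0))
        · intro ρ hρ; exact (hcont ρ (hRep_sub (hmemT ρ hρ).1)).mono (hsub ρ hρ)
        · intro ρ hρ u hu; exact (hsol ρ (hRep_sub (hmemT ρ hρ).1) u (hsub ρ hρ hu)).1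
        · intro ρ hρ u hu; exact (hsol ρ (hRep_sub (hmemT ρ hρ).1) u (hsub ρ hρ hu)).2
        · intro ρ hρ ρ' hρ' hne u hu
          exact hdisj ρ (hmemT ρ hρ).1 ρ' (hmemT ρ' hρ').1 hne u (hsub ρ hρ hu) (hsub ρ' hρ' hu)
        · intro ρ hρ; rw [← (hmemT ρ hρ).2.2]; exact (hmemT ρ hρ).2.1
    have hroot : ∀ ρ ∈ Z, ∀ t ∈ ({ω ρ} : Finset ℝ), 0 < t ∧ (a 0).IsRoot t := by
      intro ρ hρ t ht
      rw [Finset.mem_singleton] at ht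
      subst ht
      have hρRt : ρ ∈ Rt := hRep_sub (hmemZ ρ hρ).1
      have hw0 : 0 < ω ρ := ((hRt_mem ρ).1 hρRt).1.trans (htω ρ hρRt)
      refine ⟨hw0, ?_⟩
      have h1 : 1 ≤ (a 0).rootMultiplicity (ω ρ) := by
        refine le_trans ?_ (hfib (ω ρ))
        rw [Nat.one_le_iff_ne_zero, ← Nat.pos_iff_ne_zero, Finset.card_pos]
        exact ⟨ρ, Finset.mem_filter.2 ⟨hρ, Finset.mem_singleton_self _⟩⟩
      exact (rootMultiplicity_pos ha0).1 h1
    calc Z.card = ∑ ρ ∈ Z, (({ω ρ} : Finset ℝ)).card := by simp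
      _ ≤ Multiset.card ((a 0).roots.filter (fun t => 0 < t)) :=
          sum_card_le_card_roots (a 0) ha0 Z (fun ρ => ({ω ρ} : Finset ℝ)) hroot hfib
  -- STEP 4c: ESCAPE ends, charged to `a_r` through the reflected family
  have hE_le : E.card ≤ Multiset.card ((a r).roots.filter (fun t => 0 < t)) := by
    have hmemE : ∀ ρ ∈ E, ρ ∈ Rep ∧ Tendsto (β ρ) (𝓝[<] (ω ρ)) atTop := fun ρ hρ => Finset.mem_filter.1 hρ
    have hfib : ∀ w : ℝ, (E.filter (fun ρ => w ∈ ({ω ρ} : Finset ℝ))).card ≤ (a r).rootMultiplicity w := by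
      intro w
      set T : Finset ℝ := E.filter (fun ρ => w ∈ ({ω ρ} : Finset ℝ)) with hT
      have hmemT : ∀ ρ ∈ T, ρ ∈ Rep ∧ Tendsto (β ρ) (𝓝[<] (ω ρ)) atTop ∧ ω ρ = w := by
        intro ρ hρ
        obtain ⟨hρE, hw⟩ := Finset.mem_filter.1 hρ
        exact ⟨(hmemE ρ hρE).1, (hmemE ρ hρE).2, (Finset.mem_singleton.1 hw).symm⟩
      rcases T.eq_empty_or_nonempty with hTe | hTne
      · rw [hTe, Finset.card_empty]; exact Nat.zero_le _
      · set s := T.max' hTne with hsdef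
        have hsT : s ∈ T := Finset.max'_mem T hTne
        have hsRt : s ∈ Rt := hRep_sub (hmemT s hsT).1
        have hs0 : 0 < s := ((hRt_mem s).1 hsRt).1
        have hsw : s < w := by rw [← (hmemT s hsT).2.2]; exact htω s hsRt
        have hw0 : 0 < w := hs0.trans hsw
        have hαs : ∀ ρ ∈ T, α ρ < s := fun ρ hρ =>
          (hαt ρ (hRep_sub (hmemT ρ hρ).1)).trans_le (Finset.le_max' T ρ hρ)
        have hsub : ∀ ρ ∈ T, Ioo s w ⊆ Ioo (α ρ) (ω ρ) := fun ρ hρ u hu =>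
          ⟨(hαs ρ hρ).trans hu.1, by rw [(hmemT ρ hρ).2.2]; exact hu.2⟩
        have hsplit' : ∀ t, 0 < t →
            (∑ k ∈ Finset.range (r + 1), (X : ℝ[X]) ^ k * Polynomial.C ((a k).eval t)).Splits :=
          fun t ht => by rw [← hPdef]; exact hsplit t ht
        have hP0' : (∑ k ∈ Finset.range (r + 1), (X : ℝ[X]) ^ k * Polynomial.C ((a k).eval w)) ≠ 0 := by
          rw [← hPdef]; exact hPne w hw0
        have hfin' := hfin
        have hgp1' := hgp1
        rw [hosc, hΦ] at hfin' hgp1'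
        have key := card_le_rootMultiplicity_reflect_of_tendsto_atTop r a hsplit' hfin' hgp1' T β hs0 hsw hP0'
          (fun ρ hρ => (hcont ρ (hRep_sub (hmemT ρ hρ).1)).mono (hsub ρ hρ))
          (fun ρ hρ u hu => (hsol ρ (hRep_sub (hmemT ρ hρ).1) u (hsub ρ hρ hu)).1)
          (fun ρ hρ u hu => by rw [← hΦ]; exact (hsol ρ (hRep_sub (hmemT ρ hρ).1) u (hsub ρ hρ hu)).2)
          (fun ρ hρ ρ' hρ' hne u hu => hdisj ρ (hmemT ρ hρ).1 ρ' (hmemT ρ' hρ').1 hne u (hsub ρ hρ hu) (hsub ρ' hρ' hu))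
          (fun ρ hρ => by rw [← (hmemT ρ hρ).2.2]; exact (hmemT ρ hρ).2.1)
        rw [← hPr] at key
        exact key.trans (hcostr w hw0 (hPne w hw0))
    have hroot : ∀ ρ ∈ E, ∀ t ∈ ({ω ρ} : Finset ℝ), 0 < t ∧ (a r).IsRoot t := by
      intro ρ hρ t ht
      rw [Finset.mem_singleton] at ht
      subst ht
      have hρRt : ρ ∈ Rt := hRep_sub (hmemE ρ hρ).1
      have hw0 : 0 < ω ρ := ((hRt_mem ρ).1 hρRt).1.trans (htω ρ hρRt)
      refine ⟨hw0, ?_⟩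
      have h1 : 1 ≤ (a r).rootMultiplicity (ω ρ) := by
        refine le_trans ?_ (hfib (ω ρ))
        rw [Nat.one_le_iff_ne_zero, ← Nat.pos_iff_ne_zero, Finset.card_pos]
        exact ⟨ρ, Finset.mem_filter.2 ⟨hρ, Finset.mem_singleton_self _⟩⟩
      exact (rootMultiplicity_pos har).1 h1
    calc E.card = ∑ ρ ∈ E, (({ω ρ} : Finset ℝ)).card := by simp
      _ ≤ Multiset.card ((a r).roots.filter (fun t => 0 < t)) :=
          sum_card_le_card_roots (a r) har E (fun ρ => ({ω ρ} : Finset ℝ)) hroot hfib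
  have hsum2 : ∑ ρ ∈ Rep, Multiset.card (g.roots.filter (fun t => α ρ < t ∧ t < ω ρ ∧ β ρ t = c * t ^ N)) ≤
      ∑ ρ ∈ Rep, 2 * ((hfin.toFinset.filter (fun p => α ρ < p 0 ∧ p 0 < ω ρ ∧ p 1 = β ρ (p 0))).card + 1) :=
    Finset.sum_le_sum hstep2
  rw [← Finset.mul_sum, Finset.sum_add_distrib, Finset.sum_const, smul_eq_mul, mul_one] at hsum2
  calc Multiset.card M
      ≤ ∑ ρ ∈ Rep, Multiset.card (g.roots.filter (fun t => α ρ < t ∧ t < ω ρ ∧ β ρ t = c * t ^ N)) := hstep1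
    _ ≤ 2 * (∑ ρ ∈ Rep, (hfin.toFinset.filter (fun p => α ρ < p 0 ∧ p 0 < ω ρ ∧ p 1 = β ρ (p 0))).card
          + Rep.card) := hsum2
    _ ≤ 2 * (osc.ncard + (r + Multiset.card ((a 0).roots.filter (fun t => 0 < t))
          + Multiset.card ((a r).roots.filter (fun t => 0 < t)))) := by
        have := hRep_le; have := hA_le; have := hZ_le; have := hE_le; have := hstep3
        nlinarith
    _ = 2 * osc.ncard + 2 * r + 2 * Multiset.card ((a 0).roots.filter (fun t => 0 < t))
          + 2 * Multiset.card ((a r).roots.filter (fun t => 0 < t)) := by ring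

end OsculationPeel

end Summit.ValiantsHypothesis.ValiantsHypothesis.Theorems.LacunarySymmetroidMatrixDescartes

end
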